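import Summits.Ventures.YMGap.RobustBall.Defs
import HarnessLib

/-!
# RobustBall/RectangleCode — the polymer of a based `1×2` rectangle: membership, diameter, injectivity, counts
(cell `pub-ymgap`, track Y2 ROBUST-BALL, T0.2 witness (w1); p1)

HONEST FRAMING: finite-torus combinatorics only (no probability, no continuum, no Clay claim).

The based `1×2` rectangle `(x; i, j)` (`i ≠ j`; short side `e_i`, long side `2 e_j`) is carried by the polymer
`rectCode x i j = {x, x+e_i, x+e_j, x+e_i+e_j, x+e_j+e_j}` — the base points of its six links. We prove, on the
torus `(ℤ/L)^d`:
* every point of the code is `x + a e_i + b e_j` with `a ≤ 1`, `b ≤ 2`, so the code has `torusNorm`-diameter `≤ 2`;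
* for `3 ≤ L` the code DETERMINES `(x, i, j)` (`rectCode_injective`): `j` is the only direction showing three distinct
  coordinate values, `i` the only other non-constant one, and `x` is read off the two columns — needed because the
  witness perturbation places each rectangle's activity on its own polymer;
* the direction counts `#{(i,j) : i ≠ j, i = k} = #{(i,j) : i ≠ j, j = k} = d − 1` behind the load numbers
  `12(d−1)|τ|`, `36(d−1)|τ|/√N` of `RectangleWitnessTarget`.
-/

noncomputable section

open Finset Function
open Literature.MathematicalPhysics.QuantumLattice hiding torusNorm
open Literature.MathematicalPhysics.QuantumFieldTheory hiding ZdEdge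

namespace Summit.Ventures.YMGap.RobustBall

variable {d L : ℕ}

/-- The unit vector `e_k` of the torus `(ℤ/L)^d`. [folklore] -/
def unitVec (k : Fin d) : Site d L := Pi.single k 1

/-- `e_k` has `k`-coordinate `1`. [folklore] -/
@[simp] theorem unitVec_apply_self (k : Fin d) : (unitVec k : Site d L) k = 1 := by simp [unitVec]

/-- `e_k` has vanishing `k'`-coordinate for `k' ≠ k`. [folklore] -/
theorem unitVec_apply_of_ne {k k' : Fin d} (h : k' ≠ k) : (unitVec k : Site d L) k' = 0 := by
  simp [unitVec, Pi.single_eq_of_ne h]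

/-- The polymer of the based `1×2` rectangle `(x; i, j)`: the base points of its six links. [folklore] -/
def rectCode (x : Site d L) (i j : Fin d) : Finset (Site d L) :=
  {x, x + unitVec i, x + unitVec j, x + unitVec i + unitVec j, x + unitVec j + unitVec j}

/-! ### Coordinates of the code points -/

section Coordinates

variable {x : Site d L} {i j : Fin d}

/-- Off the two directions `i, j` every code point agrees with `x`. [folklore] -/
theorem apply_eq_of_mem_rectCode {p : Site d L} (hp : p ∈ rectCode x i j) {k : Fin d} (hki : k ≠ i) (hkj : k ≠ j) :
    p k = x k := by
  simp only [rectCode, mem_insert, mem_singleton] at hp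
  rcases hp with rfl | rfl | rfl | rfl | rfl <;> simp [unitVec_apply_of_ne hki, unitVec_apply_of_ne hkj]

/-- The `i`-coordinates of the code points are `x i` or `x i + 1`. [folklore] -/
theorem apply_fst_of_mem_rectCode (hij : i ≠ j) {p : Site d L} (hp : p ∈ rectCode x i j) :
    p i = x i ∨ p i = x i + 1 := by
  simp only [rectCode, mem_insert, mem_singleton] at hp
  rcases hp with rfl | rfl | rfl | rfl | rfl <;> simp [unitVec_apply_of_ne hij]

/-- The `j`-coordinates of the code points in the column `p i = x i + 1` are `x j` or `x j + 1`
(provided `1 ≠ 0` in `ZMod L`). [folklore] -/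
theorem apply_snd_of_mem_rectCode_of_col (hij : i ≠ j) (h1 : (1 : ZMod L) ≠ 0) {p : Site d L}
    (hp : p ∈ rectCode x i j) (hpi : p i = x i + 1) : p j = x j ∨ p j = x j + 1 := by
  simp only [rectCode, mem_insert, mem_singleton] at hp
  rcases hp with rfl | rfl | rfl | rfl | rfl
  · exact absurd (left_eq_add.1 hpi) h1
  · left; simp [unitVec_apply_of_ne hij.symm]
  · simp only [Pi.add_apply, unitVec_apply_of_ne hij, add_zero] at hpi
    exact absurd (left_eq_add.1 hpi) h1
  · right; simp [unitVec_apply_of_ne hij.symm]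
  · simp only [Pi.add_apply, unitVec_apply_of_ne hij, add_zero] at hpi
    exact absurd (left_eq_add.1 hpi) h1

/-- The code is constant in no direction other than `i, j`: characterisation of `i, j` as the NON-CONSTANT
directions (`1 ≠ 0`). [folklore] -/
theorem exists_apply_ne_iff (h1 : (1 : ZMod L) ≠ 0) (k : Fin d) :
    (∃ p ∈ rectCode x i j, ∃ q ∈ rectCode x i j, p k ≠ q k) ↔ (k = i ∨ k = j) := by
  constructor
  · rintro ⟨p, hp, q, hq, hpq⟩
    by_contra hk
    obtain ⟨hki, hkj⟩ := not_or.1 hk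
    exact hpq ((apply_eq_of_mem_rectCode hp hki hkj).trans (apply_eq_of_mem_rectCode hq hki hkj).symm)
  · rintro (rfl | rfl)
    · exact ⟨x + unitVec k, by simp [rectCode], x, by simp [rectCode],
        fun h => h1 (add_eq_left.1 (by simpa only [Pi.add_apply, unitVec_apply_self] using h))⟩
    · exact ⟨x + unitVec k, by simp [rectCode], x, by simp [rectCode],
        fun h => h1 (add_eq_left.1 (by simpa only [Pi.add_apply, unitVec_apply_self] using h))⟩

/-- `j` is the only direction in which the code shows THREE distinct coordinate values (`1, 2 ≠ 0`). [folklore] -/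
theorem exists_three_iff (hij : i ≠ j) (h1 : (1 : ZMod L) ≠ 0) (h2 : (2 : ZMod L) ≠ 0) (k : Fin d) :
    (∃ p ∈ rectCode x i j, ∃ q ∈ rectCode x i j, ∃ s ∈ rectCode x i j, p k ≠ q k ∧ p k ≠ s k ∧ q k ≠ s k) ↔
      k = j := by
  constructor
  · rintro ⟨p, hp, q, hq, s, hs, hpq, hps, hqs⟩
    by_contra hk
    by_cases hki : k = i
    · subst hki
      rcases apply_fst_of_mem_rectCode hij hp with hp' | hp' <;>
        rcases apply_fst_of_mem_rectCode hij hq with hq' | hq' <;>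
          rcases apply_fst_of_mem_rectCode hij hs with hs' | hs'
      all_goals first
        | exact hpq (hp'.trans hq'.symm) | exact hps (hp'.trans hs'.symm) | exact hqs (hq'.trans hs'.symm)
    · exact hpq ((apply_eq_of_mem_rectCode hp hki hk).trans (apply_eq_of_mem_rectCode hq hki hk).symm)
  · rintro rfl
    refine ⟨x, by simp [rectCode], x + unitVec k, by simp [rectCode], x + unitVec k + unitVec k, by simp [rectCode],
      ?_, ?_, ?_⟩
    · simp only [Pi.add_apply, unitVec_apply_self]
      exact fun h => h1 (left_eq_add.1 h)
    · simp only [Pi.add_apply, unitVec_apply_self, add_assoc, one_add_one_eq_two]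
      exact fun h => h2 (left_eq_add.1 h)
    · simp only [Pi.add_apply, unitVec_apply_self]
      exact fun h => h1 (left_eq_add.1 h)

end Coordinates

/-! ### Injectivity of the code (`3 ≤ L`) -/

/-- `(1 : ZMod L) ≠ 0` for `3 ≤ L`. [folklore] -/
theorem one_ne_zero_of_three_le (hL : 3 ≤ L) : (1 : ZMod L) ≠ 0 := by
  haveI : Fact (1 < L) := ⟨by omega⟩
  exact one_ne_zero

/-- `(2 : ZMod L) ≠ 0` for `3 ≤ L`. [folklore] -/
theorem two_ne_zero_of_three_le (hL : 3 ≤ L) : (2 : ZMod L) ≠ 0 := by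
  intro h
  have h2 : ((2 : ℕ) : ZMod L) = 0 := by exact_mod_cast h
  rw [ZMod.natCast_eq_zero_iff] at h2
  exact absurd (Nat.le_of_dvd two_pos h2) (by omega)

/-- Two values `a, a'` with `a' ∈ {a, a+1}` and `a ∈ {a', a'+1}` coincide (`2 ≠ 0`). [folklore] -/
theorem eq_of_mem_pair_of_mem_pair {a a' : ZMod L} (h2 : (2 : ZMod L) ≠ 0)
    (ha' : a' = a ∨ a' = a + 1) (ha : a = a' ∨ a = a' + 1) : a' = a := by
  rcases ha' with h | h
  · exact h
  rcases ha with h' | h'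
  · exact h'.symm
  rw [h, add_assoc, one_add_one_eq_two] at h'
  exact absurd (left_eq_add.1 h') h2

/-- **The code determines the rectangle** (`3 ≤ L`, `i ≠ j`, `i' ≠ j'`). [folklore] -/
theorem rectCode_injective (hL : 3 ≤ L) {x x' : Site d L} {i j i' j' : Fin d} (hij : i ≠ j) (hij' : i' ≠ j')
    (h : rectCode x i j = rectCode x' i' j') : x = x' ∧ i = i' ∧ j = j' := by
  have h1 := one_ne_zero_of_three_le hL
  have h2 := two_ne_zero_of_three_le hL
  -- `j = j'`: three distinct values
  have hj : j' = j := by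
    have := (exists_three_iff (x := x') hij' h1 h2 j').2 rfl
    rw [← h] at this
    exact (exists_three_iff hij h1 h2 j').1 this
  subst hj
  -- `i = i'`: non-constant and `≠ j`
  have hi : i' = i := by
    have := (exists_apply_ne_iff (x := x') (i := i') (j := j') h1 i').2 (Or.inl rfl)
    rw [← h] at this
    rcases (exists_apply_ne_iff (x := x) (i := i) (j := j') h1 i').1 this with h' | h'
    · exact h'
    · exact absurd h' hij'
  subst hi
  refine ⟨funext fun k => ?_, rfl, rfl⟩
  have hx' : x' ∈ rectCode x i' j' := by rw [h]; simp [rectCode]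
  have hx : x ∈ rectCode x' i' j' := by rw [← h]; simp [rectCode]
  by_cases hki : k = i'
  · subst hki
    exact (eq_of_mem_pair_of_mem_pair h2 (apply_fst_of_mem_rectCode hij hx')
      (apply_fst_of_mem_rectCode hij' hx)).symm
  by_cases hkj : k = j'
  · subst hkj
    have hxi : x' i' = x i' := eq_of_mem_pair_of_mem_pair h2 (apply_fst_of_mem_rectCode hij hx')
      (apply_fst_of_mem_rectCode hij' hx)
    have hp : x' + unitVec i' ∈ rectCode x i' k := by rw [h]; simp [rectCode]
    have hq : x + unitVec i' ∈ rectCode x' i' k := by rw [← h]; simp [rectCode]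
    have hp' := apply_snd_of_mem_rectCode_of_col hij h1 hp (by simp [unitVec_apply_self, hxi])
    have hq' := apply_snd_of_mem_rectCode_of_col hij' h1 hq (by simp [unitVec_apply_self, hxi])
    simp only [Pi.add_apply, unitVec_apply_of_ne hij'.symm, add_zero] at hp' hq'
    exact (eq_of_mem_pair_of_mem_pair h2 hp' hq').symm
  · exact (apply_eq_of_mem_rectCode hx' hki hkj).symm

/-! ### Diameter of the code -/

/-- Periodic sup-norm of an integer combination of two distinct unit vectors. [folklore] -/
theorem torusNorm_single_add_single_le {i j : Fin d} (hij : i ≠ j) (m n : ℤ) :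
    torusNorm ((Pi.single i (m : ZMod L) : Site d L) + Pi.single j (n : ZMod L)) ≤ max m.natAbs n.natAbs := by
  refine Finset.sup_le fun k _ => ?_
  by_cases hki : k = i
  · subst hki
    simp only [Pi.add_apply, Pi.single_eq_same, Pi.single_eq_of_ne hij, add_zero]
    exact (natAbs_valMinAbs_intCast_le L m).trans (le_max_left _ _)
  by_cases hkj : k = j
  · subst hkj
    simp only [Pi.add_apply, Pi.single_eq_same, Pi.single_eq_of_ne hki, zero_add]
    exact (natAbs_valMinAbs_intCast_le L n).trans (le_max_right _ _)
  · simp [Pi.single_eq_of_ne hki, Pi.single_eq_of_ne hkj]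

/-- Every code point is `x + a e_i + b e_j` with `a ≤ 1`, `b ≤ 2`. [folklore] -/
theorem exists_offsets_of_mem_rectCode {x : Site d L} {i j : Fin d} {p : Site d L} (hp : p ∈ rectCode x i j) :
    ∃ a b : ℕ, a ≤ 1 ∧ b ≤ 2 ∧ p = x + (Pi.single i (a : ZMod L) + Pi.single j (b : ZMod L)) := by
  simp only [rectCode, mem_insert, mem_singleton] at hp
  rcases hp with rfl | rfl | rfl | rfl | rfl
  · exact ⟨0, 0, by norm_num, by norm_num, by simp⟩
  · exact ⟨1, 0, by norm_num, by norm_num, by simp [unitVec]⟩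
  · exact ⟨0, 1, by norm_num, by norm_num, by simp [unitVec]⟩
  · exact ⟨1, 1, by norm_num, by norm_num, by simp [unitVec, add_assoc]⟩
  · refine ⟨0, 2, by norm_num, by norm_num, ?_⟩
    simp only [unitVec, Nat.cast_zero, Pi.single_zero, zero_add, Nat.cast_ofNat, add_assoc, ← Pi.single_add]
    norm_num

/-- **The code has periodic sup-diameter `≤ 2`** (`i ≠ j`). [folklore] -/
theorem polymerDiam_rectCode_le {x : Site d L} {i j : Fin d} (hij : i ≠ j) : polymerDiam (rectCode x i j) ≤ 2 := by
  refine Finset.sup_le fun p hp => Finset.sup_le fun q hq => ?_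
  obtain ⟨a, b, ha, hb, rfl⟩ := exists_offsets_of_mem_rectCode hp
  obtain ⟨a', b', ha', hb', rfl⟩ := exists_offsets_of_mem_rectCode hq
  have hsub : x + (Pi.single i ((a : ℕ) : ZMod L) + Pi.single j ((b : ℕ) : ZMod L)) -
      (x + (Pi.single i ((a' : ℕ) : ZMod L) + Pi.single j ((b' : ℕ) : ZMod L))) =
      (Pi.single i (((a : ℤ) - a' : ℤ) : ZMod L) : Site d L) + Pi.single j (((b : ℤ) - b' : ℤ) : ZMod L) := by
    simp only [Int.cast_sub, Int.cast_natCast, Pi.single_sub]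
    abel
  rw [hsub]
  refine (torusNorm_single_add_single_le hij _ _).trans (max_le ?_ ?_) <;> omega

/-! ### Direction counts -/

/-- The index set of ordered pairs of distinct directions. [folklore] -/
abbrev DirPair (d : ℕ) : Type := {p : Fin d × Fin d // p.1 ≠ p.2}

/-- `#{j : j ≠ k} = d − 1`. [folklore] -/
theorem card_ne_eq (k : Fin d) : Fintype.card {j : Fin d // j ≠ k} = d - 1 := by
  rw [Fintype.card_subtype, filter_ne', card_erase_of_mem (mem_univ k), card_univ, Fintype.card_fin]

/-- `#{(i, j) : i ≠ j, i = k} = d − 1`. [folklore] -/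
theorem card_dirPair_fst_eq (k : Fin d) : (univ.filter fun p : DirPair d => p.1.1 = k).card = d - 1 := by
  have e : {p : DirPair d // p.1.1 = k} ≃ {j : Fin d // j ≠ k} :=
    { toFun := fun p => ⟨p.1.1.2, fun h => p.1.2 (p.2.trans h.symm)⟩
      invFun := fun j => ⟨⟨(k, j.1), fun h => j.2 h.symm⟩, rfl⟩
      left_inv := fun ⟨⟨⟨a, b⟩, hab⟩, ha⟩ => by subst ha; rfl
      right_inv := fun _ => rfl }
  rw [← Fintype.card_subtype, Fintype.card_congr e, card_ne_eq]

/-- `#{(i, j) : i ≠ j, j = k} = d − 1`. [folklore] -/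
theorem card_dirPair_snd_eq (k : Fin d) : (univ.filter fun p : DirPair d => p.1.2 = k).card = d - 1 := by
  have e : {p : DirPair d // p.1.2 = k} ≃ {j : Fin d // j ≠ k} :=
    { toFun := fun p => ⟨p.1.1.1, fun h => p.1.2 (h.trans p.2.symm)⟩
      invFun := fun j => ⟨⟨(j.1, k), fun h => j.2 h⟩, rfl⟩
      left_inv := fun ⟨⟨⟨a, b⟩, hab⟩, hb⟩ => by subst hb; rfl
      right_inv := fun _ => rfl }
  rw [← Fintype.card_subtype, Fintype.card_congr e, card_ne_eq]

/-- **Translation count**: for fixed offset `c` and direction `k`, exactly one base point `x` puts the letter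
`(x + c, k)` on a given link `e` (iff `k = e.2`). [folklore] -/
theorem sum_ite_translate_eq [NeZero L] (c : Site d L) (k : Fin d) (e : Edge d L) :
    ∑ x : Site d L, (if (x + c, k) = e then (1 : ℕ) else 0) = if k = e.2 then 1 else 0 := by
  have : ∀ x : Site d L, ((x + c, k) = e) ↔ (x = e.1 - c ∧ k = e.2) := fun x => by
    rw [Prod.ext_iff, eq_sub_iff_add_eq]
  simp_rw [this, ite_and]
  rw [sum_ite_eq']
  simp

/-- **Direction count over the rectangle index set**: `Σ_{(i,j)} [i = k] = Σ_{(i,j)} [j = k] = d − 1`. [folklore] -/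
theorem sum_dirPair_ite_fst_eq (k : Fin d) : ∑ p : DirPair d, (if p.1.1 = k then (1 : ℕ) else 0) = d - 1 := by
  rw [← card_dirPair_fst_eq k, card_eq_sum_ones, sum_filter]

/-- Second-coordinate version of `sum_dirPair_ite_fst_eq`. [folklore] -/
theorem sum_dirPair_ite_snd_eq (k : Fin d) : ∑ p : DirPair d, (if p.1.2 = k then (1 : ℕ) else 0) = d - 1 := by
  rw [← card_dirPair_snd_eq k, card_eq_sum_ones, sum_filter]

end Summit.Ventures.YMGap.RobustBall

end
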